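import Literature.Barriers.CriticalPhenomena.TimarCutClasses
import Literature.Barriers.CriticalPhenomena.TimarOnePartitionQuasiTransitive
import Literature.Barriers.CriticalPhenomena.TimarLevelExhaustionQuasiTransitive
import HarnessLib

/-!
# The classes of the cut route to Timár 2006, Thm. 5.5 on QUASI-TRANSITIVE graphs — PROVED

Barrier catalogue `Literature/Barriers/CriticalPhenomena/`; the quasi-transitive twin of
`TimarCutClasses.lean` (TRANSITIVE graphs), verbatim on the quasi-transitive 1-partition
`OnePartitionRelQ` (`TimarOnePartitionQuasiTransitive.lean`) and the quasi-transitive level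
exhaustion `LevelExhaustionRelQ` (`TimarLevelExhaustionQuasiTransitive.lean`), with the extreme edge
ratio `δ = minEdgeRatio G` for `Δ`. Á. Timár, *Percolation on nonunimodular transitive graphs*,
Ann. Probab. 34 (2006) 2344–2364, proof of Thm. 5.5 (p. 2360): "Consider the invariant exhaustion
`P_i` of the set of levels of `G` by finite partitions … two vertices are in the same class of `R_i`
iff they belong to the same connected component of some `ω_A`."

Contents: `exhLevelSetQ`, `cutClassQ`, partition properties, `cutClassQ_finite` (from `LevelBad`),
the weight bound `autWeight_le_of_mem_cutClassQ` (`w(x) ≤ δ⁻¹ w(y)` inside a class), invariance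
`mem_cutClassQ_act_iff`, measurability `measurableSet_mem_cutClassQ`, and `mem_cutClassQ_of_walk`.

## References

* Á. Timár, Ann. Probab. 34 (2006) 2344–2364 (arXiv:math/0702875), §5: proof of Thm. 5.5 (the
  partitions `R_i`), Prop. 5.4, the 1-partition. [Timar2006]
* T. Hutchcroft, C. R. Math. Acad. Sci. Paris 354 (2016) 944–947, §2 (quasi-transitive setting).
  [Hutchcroft2016]
-/

noncomputable section

namespace Literature.Barriers.CriticalPhenomena

open _root_.MeasureTheory Literature.Probability.Percolation SimpleGraph
open scoped _root_.ENNReal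

variable {V : Type*} (G : SimpleGraph V) [G.LocallyFinite] (hconn : G.Connected)
  (hqt : IsQuasiTransitive G) (o : V)

/-! ### The classes -/

/-- The union `L_A(x)` of the levels of the class of `x` in the `m`-th partition of the levels
("Each class `A` in `P_i` contains finitely many levels of `G`: call their union `L_A`").
[cite: Timar2006, Thm. 5.5 (proof: the sets L_A)] -/
def exhLevelSetQ (m : ℕ) (ξ : ExhaustionSeeds (heightGroupQ G hqt o)) (x : V) : Set V :=
  {v | LevelExhaustionRelQ G hconn hqt o m ξ x v}

/-- **The cut class** of `x` at stage `m`: the points of `D` in the class of `x` of the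
1-partition that are joined to `x` by an open path inside `L_A(x)` ("two vertices are in the
same class of `R_i` iff they belong to the same connected component of some `ω_A`", restricted to
the points of the forest inside one class of the 1-partition).
[cite: Timar2006, Thm. 5.5 (proof: the partitions R_i)] -/
def cutClassQ (θ : UnitAddCircle) (m : ℕ) (ξ : ExhaustionSeeds (heightGroupQ G hqt o)) (ω : BondConfig V)
    (D : Set V) (x : V) : Set V :=
  {y | y ∈ D ∧ OnePartitionRelQ G o θ x y ∧
    y ∈ openClusterIn (withinGraph G (exhLevelSetQ G hconn hqt o m ξ x)) ω x}

variable {G hconn hqt o}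

/-- `x ∈ L_A(x)`. [folklore] -/
theorem mem_exhLevelSet_selfQ (m : ℕ) (ξ : ExhaustionSeeds (heightGroupQ G hqt o)) (x : V) :
    x ∈ exhLevelSetQ G hconn hqt o m ξ x :=
  (levelExhaustionRelQ_equivalence G hconn hqt o m ξ).refl x

/-- Related vertices have the same `L_A`. [folklore] -/
theorem exhLevelSet_eq_of_memQ {m : ℕ} {ξ : ExhaustionSeeds (heightGroupQ G hqt o)} {x y : V}
    (h : y ∈ exhLevelSetQ G hconn hqt o m ξ x) : exhLevelSetQ G hconn hqt o m ξ y = exhLevelSetQ G hconn hqt o m ξ x := by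
  have hE := levelExhaustionRelQ_equivalence G hconn hqt o m ξ
  ext v
  exact ⟨fun hv => hE.trans h hv, fun hv => hE.trans (hE.symm h) hv⟩

/-- A point of `D` lies in its own class. [folklore] -/
theorem mem_cutClass_selfQ {θ : UnitAddCircle} {m : ℕ} {ξ : ExhaustionSeeds (heightGroupQ G hqt o)}
    {ω : BondConfig V} {D : Set V} {x : V} (hx : x ∈ D) :
    x ∈ cutClassQ G hconn hqt o θ m ξ ω D x :=
  ⟨hx, (onePartitionRelQ_equivalence G o θ).refl x, self_mem_openClusterIn _ ω x⟩

/-- Classes consist of points of `D`. [folklore] -/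
theorem cutClass_subsetQ (θ : UnitAddCircle) (m : ℕ) (ξ : ExhaustionSeeds (heightGroupQ G hqt o))
    (ω : BondConfig V) (D : Set V) (x : V) : cutClassQ G hconn hqt o θ m ξ ω D x ⊆ D :=
  fun _ hy => hy.1

/-- A vertex of the class of `x` lies in `L_A(x)`. [folklore] -/
theorem mem_exhLevelSet_of_mem_cutClassQ {θ : UnitAddCircle} {m : ℕ}
    {ξ : ExhaustionSeeds (heightGroupQ G hqt o)} {ω : BondConfig V} {D : Set V} {x y : V}
    (hy : y ∈ cutClassQ G hconn hqt o θ m ξ ω D x) : y ∈ exhLevelSetQ G hconn hqt o m ξ x :=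
  openClusterIn_withinGraph_subset (mem_exhLevelSet_selfQ m ξ x) ω hy.2.2

/-- **The classes partition `D`**: a point of the class of `x` has the same class. [folklore] -/
theorem cutClass_eq_of_memQ {θ : UnitAddCircle} {m : ℕ} {ξ : ExhaustionSeeds (heightGroupQ G hqt o)}
    {ω : BondConfig V} {D : Set V} {x y : V} (hy : y ∈ cutClassQ G hconn hqt o θ m ξ ω D x) :
    cutClassQ G hconn hqt o θ m ξ ω D y = cutClassQ G hconn hqt o θ m ξ ω D x := by
  have hP := onePartitionRelQ_equivalence G o θ
  have hL : exhLevelSetQ G hconn hqt o m ξ y = exhLevelSetQ G hconn hqt o m ξ x :=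
    exhLevelSet_eq_of_memQ (mem_exhLevelSet_of_mem_cutClassQ hy)
  have hC : openClusterIn (withinGraph G (exhLevelSetQ G hconn hqt o m ξ x)) ω y =
      openClusterIn (withinGraph G (exhLevelSetQ G hconn hqt o m ξ x)) ω x :=
    openClusterIn_eq_of_mem hy.2.2
  ext z
  simp only [cutClassQ, Set.mem_setOf_eq, hL, hC]
  exact ⟨fun ⟨hz, hr, hc⟩ => ⟨hz, hP.trans hy.2.1 hr, hc⟩,
    fun ⟨hz, hr, hc⟩ => ⟨hz, hP.trans (hP.symm hy.2.1) hr, hc⟩⟩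

/-- **The class of a point of a bad cluster is finite** ("By our assumption, every `ω_A` has
only finite components"): `L_A(x)` is a finite union of levels and the constrained cluster of a
vertex of a bad cluster inside a finite union of levels is finite.
[cite: Timar2006, Thm. 5.5 (proof: "every ω_A has only finite components")] -/
theorem cutClass_finiteQ {θ : UnitAddCircle} {m : ℕ} {ξ : ExhaustionSeeds (heightGroupQ G hqt o)}
    {ω : BondConfig V} {D : Set V} {x : V} (hbad : LevelBad G ω x) :
    (cutClassQ G hconn hqt o θ m ξ ω D x).Finite := by
  obtain ⟨S, hS⟩ := exists_setOf_levelExhaustionRelQ_eq_levelUnion G hconn hqt o m ξ x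
  have hfin := hbad S x (mem_openCluster_self ω x)
  have hL : exhLevelSetQ G hconn hqt o m ξ x = levelUnion G S := hS
  refine (hL ▸ hfin).subset fun y hy => hy.2.2

/-- **The weight bound inside a class**: `w(x) ≤ Δ⁻¹ w(y)` for `y` in the class of `x` (both lie
in one class of the 1-partition, a slab `(Δ b, b]`).
[cite: Timar2006, §5 ("each class in the 1-partition is a slab") and Lemma 5.1 (endpoints in one class)] -/
theorem autWeight_le_of_mem_cutClassQ (hU : ¬ IsGraphUnimodular G) {θ : UnitAddCircle} {m : ℕ}
    {ξ : ExhaustionSeeds (heightGroupQ G hqt o)} {ω : BondConfig V} {D : Set V} {x y : V}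
    (hy : y ∈ cutClassQ G hconn hqt o θ m ξ ω D x) :
    autWeight G o x ≤ (minEdgeRatio G)⁻¹ * autWeight G o y := by
  obtain ⟨b, hb0, hbT, hslab⟩ := exists_setOf_onePartitionRelQ_eq_weightSlab (o := o) hconn hqt hU θ x
  have hxs : x ∈ weightSlab G o (minEdgeRatio G * b) b := by
    rw [← hslab]; exact (onePartitionRelQ_equivalence G o θ).refl x
  have hys : y ∈ weightSlab G o (minEdgeRatio G * b) b := by
    rw [← hslab]; exact hy.2.1
  rw [mem_weightSlab] at hxs hys
  have hΔ0 := minEdgeRatio_ne_zero hconn hqt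
  have hΔT := minEdgeRatio_ne_top hconn hU
  calc autWeight G o x ≤ b := hxs.2
    _ = (minEdgeRatio G)⁻¹ * (minEdgeRatio G * b) := by
        rw [← mul_assoc, ENNReal.inv_mul_cancel hΔ0 hΔT, one_mul]
    _ ≤ (minEdgeRatio G)⁻¹ * autWeight G o y := mul_le_mul' le_rfl hys.1.le

/-! ### Invariance under the diagonal action of `Aut(G)` -/

/-- `L_A` is moved by the action: `γ v ∈ L_A(γ x)` for the shifted seed iff `v ∈ L_A(x)`.
[cite: Timar2006, Prop. 5.4 ("invariant")] -/
theorem mem_exhLevelSet_act_iffQ (m : ℕ) (ξ : ExhaustionSeeds (heightGroupQ G hqt o)) (γ : G ≃g G) (x v : V) :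
    γ v ∈ exhLevelSetQ G hconn hqt o m (levelExhaustionActQ G hconn hqt o γ ξ) (γ x) ↔
      v ∈ exhLevelSetQ G hconn hqt o m ξ x :=
  levelExhaustionRelQ_act_iff G hconn hqt o m ξ γ x v

/-- The image of `L_A(x)` is `L_A(γ x)` for the shifted seed. [folklore] -/
theorem exhLevelSet_actQ (m : ℕ) (ξ : ExhaustionSeeds (heightGroupQ G hqt o)) (γ : G ≃g G) (x : V) :
    exhLevelSetQ G hconn hqt o m (levelExhaustionActQ G hconn hqt o γ ξ) (γ x) =
      (γ : V → V) '' exhLevelSetQ G hconn hqt o m ξ x := by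
  ext v
  constructor
  · intro hv
    refine ⟨γ.symm v, ?_, γ.apply_symm_apply v⟩
    rw [← mem_exhLevelSet_act_iffQ m ξ γ, γ.apply_symm_apply]; exact hv
  · rintro ⟨w, hw, rfl⟩; exact (mem_exhLevelSet_act_iffQ m ξ γ x w).2 hw

/-- **Invariance of the cut classes** under the diagonal action of `Aut(G)` on
`(ω, θ, ξ, D)`: `γ y` is in the class of `γ x` for the moved data iff `y` is in the class of `x`.
[cite: Timar2006, Thm. 5.5 (proof: "an equivariant exhaustion R_i")] -/
theorem mem_cutClass_act_iffQ (θ : UnitAddCircle) (m : ℕ) (ξ : ExhaustionSeeds (heightGroupQ G hqt o))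
    (ω : BondConfig V) (D : Set V) (γ : G ≃g G) (x y : V) :
    γ y ∈ cutClassQ G hconn hqt o (onePartitionActQ G o γ θ) m (levelExhaustionActQ G hconn hqt o γ ξ)
        (BondConfig.relabel (sym2Equiv γ.toEquiv) ω) ((γ : V → V) '' D) (γ x) ↔
      y ∈ cutClassQ G hconn hqt o θ m ξ ω D x := by
  have hK : ∀ u v, (withinGraph G ((γ : V → V) '' exhLevelSetQ G hconn hqt o m ξ x)).Adj (γ.toEquiv u) (γ.toEquiv v) ↔
      (withinGraph G (exhLevelSetQ G hconn hqt o m ξ x)).Adj u v := by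
    intro u v
    rw [withinGraph_adj, withinGraph_adj]
    show G.Adj (γ u) (γ v) ∧ γ u ∈ _ ∧ γ v ∈ _ ↔ _
    rw [γ.map_rel_iff, γ.injective.mem_set_image, γ.injective.mem_set_image]
  have hC : openClusterIn (withinGraph G (exhLevelSetQ G hconn hqt o m (levelExhaustionActQ G hconn hqt o γ ξ) (γ x)))
      (BondConfig.relabel (sym2Equiv γ.toEquiv) ω) (γ x) =
      (γ : V → V) '' openClusterIn (withinGraph G (exhLevelSetQ G hconn hqt o m ξ x)) ω x := by
    rw [exhLevelSet_actQ]
    exact openClusterIn_relabel γ.toEquiv hK ω x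
  simp only [cutClassQ, Set.mem_setOf_eq]
  rw [hC, γ.injective.mem_set_image, γ.injective.mem_set_image, onePartitionRelQ_act_iff hconn]

/-! ### Measurability -/

section Measurable

variable {Ω : Type*} [MeasurableSpace Ω] [Countable V]

/-- The event "`L_A(x)` is the finite union of levels `levelUnion G S`" is measurable in the seed
read off from `Ω`. [folklore] -/
theorem measurableSet_exhLevelSet_eqQ {seed : Ω → ExhaustionSeeds (heightGroupQ G hqt o)}
    (hseed : Measurable seed) (m : ℕ) (x : V) (L : Set V) :
    MeasurableSet {ζ | exhLevelSetQ G hconn hqt o m (seed ζ) x = L} := by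
  have h : {ζ | exhLevelSetQ G hconn hqt o m (seed ζ) x = L} =
      ⋂ v, {ζ | LevelExhaustionRelQ G hconn hqt o m (seed ζ) x v ↔ v ∈ L} := by
    ext ζ
    simp only [Set.mem_setOf_eq, Set.mem_iInter, Set.ext_iff, exhLevelSetQ]
  rw [h]
  refine MeasurableSet.iInter fun v => ?_
  have hm : MeasurableSet {ζ | LevelExhaustionRelQ G hconn hqt o m (seed ζ) x v} :=
    (measurableSet_setOf_levelExhaustionRelQ G hconn hqt o m x v).preimage hseed
  by_cases hv : v ∈ L
  · simp only [hv, iff_true]; exact hm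
  · simp only [hv, iff_false]; exact hm.compl

/-- **Membership in a cut class is a measurable event** in `(ω, θ, ξ, D)` read off measurably
from any measurable space (`V` countable): a countable union over the possible values
`levelUnion G S` of `L_A(x)` of intersections of measurable events. [folklore] -/
theorem measurableSet_mem_cutClassQ {conf : Ω → BondConfig V} (hconf : Measurable conf)
    {par : Ω → UnitAddCircle} (hpar : Measurable par)
    {seed : Ω → ExhaustionSeeds (heightGroupQ G hqt o)} (hseed : Measurable seed)
    {D : Ω → Set V} (hD : ∀ x, MeasurableSet {ζ | x ∈ D ζ}) (m : ℕ) (x y : V) :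
    MeasurableSet {ζ | y ∈ cutClassQ G hconn hqt o (par ζ) m (seed ζ) (conf ζ) (D ζ) x} := by
  classical
  have h : {ζ | y ∈ cutClassQ G hconn hqt o (par ζ) m (seed ζ) (conf ζ) (D ζ) x} =
      {ζ | y ∈ D ζ} ∩ {ζ | OnePartitionRelQ G o (par ζ) x y} ∩
        ⋃ S : Finset V, ({ζ | exhLevelSetQ G hconn hqt o m (seed ζ) x = levelUnion G S} ∩
          {ζ | conf ζ ∈ openConnVia (withinGraph G (levelUnion G S)) x y}) := by
    ext ζ
    simp only [cutClassQ, Set.mem_setOf_eq, Set.mem_inter_iff, Set.mem_iUnion, openConnVia]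
    constructor
    · rintro ⟨hy, hr, hc⟩
      obtain ⟨S, hS⟩ := exists_setOf_levelExhaustionRelQ_eq_levelUnion G hconn hqt o m (seed ζ) x
      refine ⟨⟨hy, hr⟩, S, hS, ?_⟩
      have hL : exhLevelSetQ G hconn hqt o m (seed ζ) x = levelUnion G S := hS
      rw [← hL]; exact hc
    · rintro ⟨⟨hy, hr⟩, S, hS, hc⟩
      refine ⟨hy, hr, ?_⟩
      rw [hS]; exact hc
  rw [h]
  refine ((hD y).inter ((measurableSet_setOf_onePartitionRelQ x y).preimage hpar)).inter ?_
  exact MeasurableSet.iUnion fun S => (measurableSet_exhLevelSet_eqQ hseed m x _).inter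
    ((measurableSet_openConnVia _ x y).preimage hconf)

end Measurable

/-! ### Open walks inside `L_A(x)` -/

/-- **An open walk all of whose vertices are `P_m`-related to `x` stays in the class**: if
`ω ⊆ E(G)`, `t ∈ D`, `t ∼_θ x`, and `x` is joined to `t` by an open walk whose vertices `v` all
satisfy `x ∼_m v`, then `t` is in the cut class of `x` at stage `m` (contrapositive: an out-edge
of the forest is cut at stage `m` only if the levels of a joining open path are split by `P_m`).
[cite: Timar2006, Thm. 5.5 (proof: "the endpoints of any edge of Φ are in the same component of R_i with probability tending to 1")] -/
theorem mem_cutClass_of_walkQ {θ : UnitAddCircle} {m : ℕ} {ξ : ExhaustionSeeds (heightGroupQ G hqt o)}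
    {ω : BondConfig V} (hω : ω ⊆ G.edgeSet) {D : Set V} {x t : V} (htD : t ∈ D)
    (hrel : OnePartitionRelQ G o θ x t) (π : (openGraph ω).Walk x t)
    (hπ : ∀ v ∈ π.support, LevelExhaustionRelQ G hconn hqt o m ξ x v) :
    t ∈ cutClassQ G hconn hqt o θ m ξ ω D x := by
  refine ⟨htD, hrel, ?_⟩
  rw [mem_openClusterIn_iff]
  -- the walk is a walk of `openGraph ω ⊓ withinGraph G L_A(x)`
  suffices h : ∀ {a b : V} (q : (openGraph ω).Walk a b),
      (∀ v ∈ q.support, LevelExhaustionRelQ G hconn hqt o m ξ x v) →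
        (openGraph ω ⊓ withinGraph G (exhLevelSetQ G hconn hqt o m ξ x)).Reachable a b from h π hπ
  intro a b q
  induction q with
  | nil => exact fun _ => Reachable.refl _
  | @cons a c b hadj q ih =>
    intro hs
    rw [Walk.support_cons] at hs
    have ha : a ∈ exhLevelSetQ G hconn hqt o m ξ x := hs a List.mem_cons_self
    have hc : c ∈ exhLevelSetQ G hconn hqt o m ξ x := hs c (List.mem_cons_of_mem _ q.start_mem_support)
    have hG : G.Adj a c := G.mem_edgeSet.1 (hω ((openGraph_adj ω a c).1 hadj).1)
    have hstep : (openGraph ω ⊓ withinGraph G (exhLevelSetQ G hconn hqt o m ξ x)).Adj a c := by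
      rw [inf_adj, withinGraph_adj]
      exact ⟨hadj, hG, ha, hc⟩
    exact hstep.reachable.trans (ih fun v hv => hs v (List.mem_cons_of_mem _ hv))

end Literature.Barriers.CriticalPhenomena

end
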